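import Summits.QuantumFields.YangMills.Theorems.ColdStartUniversalityLatticeLangevinTimeAverageCLTEstimate
import Summits.QuantumFields.YangMills.Theorems.ColdStartUniversalityLatticeLangevinRegularFlow
import HarnessLib

/-!
# Route `ColdStartUniversality` (fixed-cut-off SZZ dynamics, sampler package): ★★★ THE CENTRAL LIMIT THEOREM FOR TIME AVERAGES OF THE
# COLD-START LANGEVIN SAMPLER — `T^(−1/2) ∫₀ᵀ (G(U_r) − μ_(β')(G)) dr ⇒ N(0, σ²(G))`, `σ²(G) = 2∫₀^∞⟨Ĝ, κ_tĜ⟩_μ dt`, EVERY deterministic start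

Helper file (seat `ym-line-csu-p1`, g35; `--supports stmt-QuantumFields-24809`).  The capstone of the fixed-cut-off sampler package: after the
mean-square and almost-sure ergodic theorems (files 49–52), Hoeffding concentration (70–84), the Green–Kubo asymptotic variance
`σ²(G) = 2∫₀^∞ ∫ Ĝ·κ_tĜ dμ_(β') dt ≥ 0` (67/89) and its batch-means estimator (86–91), this file proves that the fluctuations of the time
averages of the SU(2) SZZ dynamics ARE GAUSSIAN: for every coupling `β'`, every realising kernel family, EVERY strong solution `U` from a
deterministic start on ANY probability space and every continuous `|G| ≤ 1` (★★★ `timeAverage_clt`):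
  (i) `0 ≤ σ²(G)`;
  (ii) for every real `θ`, `E exp(iθ T^(−1/2) ∫_(0,T] Ĝ(U_r) dr) → exp(−θ²σ²(G)/2)` as `T → ∞` (real `T`);
  (iii) for every sequence `T_n → ∞` and every `Y ~ gaussianReal 0 σ²(G)` (any auxiliary space),
       `T_n^(−1/2) ∫_(0,T_n] Ĝ(U_r) dr → Y` IN DISTRIBUTION (Mathlib's `TendstoInDistribution`).
So the practitioners' error bar `σ̂/√T` (batch means, files 86–91) is an asymptotically exact Gaussian confidence interval at every fixed cut-off.
Proof: the finite-time Bernstein-block estimate of file 94b with `J(T) = ⌈T/T^(1/4)⌉` blocks of length `b(T) = T/J(T) ∈ [T^(1/4)/2, T^(1/4)]`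
(so `η_b/b → 0`, `(2β_u + 2b)/√T → 0`, `1/J → 0`), applied to the regular (progressively measurable) flow on the same space and transferred to
`U` by pathwise uniqueness; Lévy's theorem (file 92c).  THEOREMS ONLY, no definition, no sorry; [folklore] (Bhattacharya 1982; Kipnis–Varadhan 1986).
HONEST FRAMING: fixed cut-off; `σ²(G)` and all constants depend on `L, β'`; nothing is uniform in the cut-off; `UniformColdStartMixing` (24809)
is NOT restated; no crux, rung or summit statement is proved; the Yang–Mills mass gap is NOT proved.
-/

set_option autoImplicit false

noncomputable section

namespace Summit.QuantumFields.YangMills.Theorems.ColdStartUniversality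

open MeasureTheory ProbabilityTheory Filter Topology Set
open scoped NNReal ENNReal BigOperators
open Literature Literature.Probability.Process Literature.MathematicalPhysics.QuantumFieldTheory
open Literature.MathematicalPhysics.QuantumLattice (fundamentalRep fundamentalLatticeRep continuous_fundamentalRep)

/-! ## §1. Real-variable asymptotics of the block parameters -/

/-- The predictable-variance defect per unit block length vanishes for long blocks: `η_b/b → 0` where
`η_b = K + 2β_u((bσ² + K)/√(1+b) + √(1+b)) + 4β_u²`. [folklore] -/
theorem tendsto_blockDefect_div_atTop (K βu σ2 : ℝ) :
    Tendsto (fun b : ℝ => (K + 2 * βu * ((b * σ2 + K) / Real.sqrt (1 + b) + Real.sqrt (1 + b)) + 4 * βu ^ 2) / b) atTop (𝓝 0) := by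
  have hs : Tendsto (fun b : ℝ => Real.sqrt (1 + b)) atTop atTop :=
    Real.tendsto_sqrt_atTop.comp (tendsto_atTop_add_const_left _ 1 tendsto_id)
  have hsi : Tendsto (fun b : ℝ => (Real.sqrt (1 + b))⁻¹) atTop (𝓝 0) := tendsto_inv_atTop_zero.comp hs
  have h1 : Tendsto (fun b : ℝ => K / b) atTop (𝓝 0) := tendsto_const_nhds.div_atTop tendsto_id
  have h2 : Tendsto (fun b : ℝ => σ2 * (Real.sqrt (1 + b))⁻¹) atTop (𝓝 0) := by simpa using hsi.const_mul σ2
  have h3 : Tendsto (fun b : ℝ => K / (b * Real.sqrt (1 + b))) atTop (𝓝 0) :=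
    tendsto_const_nhds.div_atTop (tendsto_id.atTop_mul_atTop₀ hs)
  have h4 : Tendsto (fun b : ℝ => (b⁻¹ + 1) * (Real.sqrt (1 + b))⁻¹) atTop (𝓝 0) := by
    have := ((tendsto_inv_atTop_zero (𝕜 := ℝ)).add_const 1).mul hsi
    simpa using this
  have h5 : Tendsto (fun b : ℝ => 4 * βu ^ 2 / b) atTop (𝓝 0) := tendsto_const_nhds.div_atTop tendsto_id
  have hsum := ((h1.add (((h2.add h3).add h4).const_mul (2 * βu))).add h5)
  simp only [add_zero, mul_zero] at hsum
  refine hsum.congr' ?_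
  filter_upwards [eventually_gt_atTop (0 : ℝ)] with b hb
  have hsq : 0 < Real.sqrt (1 + b) := Real.sqrt_pos.2 (by linarith)
  have hsq' : Real.sqrt (1 + b) = (1 + b) / Real.sqrt (1 + b) := (Real.div_sqrt).symm
  have hbne : b ≠ 0 := hb.ne'
  have hsne : Real.sqrt (1 + b) ≠ 0 := hsq.ne'
  have hss : Real.sqrt (1 + b) ^ 2 = 1 + b := Real.sq_sqrt (by linarith)
  have e4 : (b⁻¹ + 1) * (Real.sqrt (1 + b))⁻¹ = Real.sqrt (1 + b) / b := by
    rw [eq_div_iff hbne]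
    field_simp
    nlinarith [hss, hsq]
  rw [e4]
  field_simp

/-- For `T ≥ 1` and `q = √(√T)`: `1 ≤ q`, `q ≤ T`, `q² = √T`. [folklore] -/
theorem sqrt_sqrt_facts {T : ℝ} (hT : 1 ≤ T) :
    1 ≤ Real.sqrt (Real.sqrt T) ∧ Real.sqrt (Real.sqrt T) ≤ T ∧ Real.sqrt (Real.sqrt T) ^ 2 = Real.sqrt T := by
  have hT0 : 0 ≤ T := by linarith
  have hs1 : 1 ≤ Real.sqrt T := Real.one_le_sqrt.2 hT
  have hq1 : 1 ≤ Real.sqrt (Real.sqrt T) := Real.one_le_sqrt.2 hs1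
  have hsT : Real.sqrt T ≤ T := (Real.sqrt_le_left hT0).2 (by nlinarith)
  have hqs : Real.sqrt (Real.sqrt T) ≤ Real.sqrt T := (Real.sqrt_le_left (by linarith)).2 (by nlinarith)
  exact ⟨hq1, hqs.trans hsT, Real.sq_sqrt (by linarith)⟩

/-! ## §2. The central limit theorem for time averages -/

variable {L : ℕ} [NeZero L]

/-- ★★★ **CENTRAL LIMIT THEOREM FOR TIME AVERAGES OF THE COLD-START SZZ SAMPLER** (every coupling, every start, every realisation, every
continuous observable).  With `Ĝ = G − μ_(β')G` and `σ² = 2∫₀^∞ ∫ Ĝ·κ_tĜ dμ_(β') dt`: `0 ≤ σ²`; `E exp(iθ T^(−1/2)∫_(0,T] Ĝ(U_r)dr) → exp(−θ²σ²/2)`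
as `T → ∞` for every real `θ`; and along every sequence `T_n → ∞`, `T_n^(−1/2)∫_(0,T_n] Ĝ(U_r)dr → Y` in distribution for every
`Y ~ gaussianReal 0 σ²`. [folklore] -/
theorem timeAverage_clt (L : ℕ) [NeZero L] (β' : ℝ)
    (κ : ℝ≥0 → Kernel (GaugeConfig 3 L (Matrix.specialUnitaryGroup (Fin 2) ℂ))
      (GaugeConfig 3 L (Matrix.specialUnitaryGroup (Fin 2) ℂ))) [∀ t, IsMarkovKernel (κ t)]
    (hreal : ∀ (t : ℝ≥0) (x : GaugeConfig 3 L (Matrix.specialUnitaryGroup (Fin 2) ℂ))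
        (Ω : Type) [MeasurableSpace Ω] (P : Measure Ω) [IsProbabilityMeasure P]
        (W : ℝ≥0 → Ω → (Edge 3 L × NoiseIdx 2 → ℝ)) (hW : IsFlatBrownian W P)
        (U : ℝ≥0 → Ω → GaugeConfig 3 L (Matrix.specialUnitaryGroup (Fin 2) ℂ)),
        (∀ ω, U 0 ω = x) →
        (latticeLangevinDynamics (fundamentalLatticeRep 2) β').IsSolution (fundamentalRep (Fin 2))
          hW.natFiltration P W U →
        κ t x = P.map (U t))
    (x : GaugeConfig 3 L (Matrix.specialUnitaryGroup (Fin 2) ℂ))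
    {Ω : Type} [MeasurableSpace Ω] {P : Measure Ω} [IsProbabilityMeasure P]
    {W : ℝ≥0 → Ω → (Edge 3 L × NoiseIdx 2 → ℝ)} (hW : IsFlatBrownian W P)
    {U : ℝ≥0 → Ω → GaugeConfig 3 L (Matrix.specialUnitaryGroup (Fin 2) ℂ)} (hU0 : ∀ ω, U 0 ω = x)
    (hU : (latticeLangevinDynamics (fundamentalLatticeRep 2) β').IsSolution (fundamentalRep (Fin 2)) hW.natFiltration P W U)
    {G : GaugeConfig 3 L (Matrix.specialUnitaryGroup (Fin 2) ℂ) → ℝ} (hGc : Continuous G) (hG1 : ∀ z, |G z| ≤ 1)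
    {σ2 : ℝ} (hσ2 : σ2 = 2 * ∫ t in Ioi (0 : ℝ),
        (∫ y, (G y - ∫ z, G z ∂(wilsonMeasure (d := 3) (L := L) (fundamentalRep (Fin 2)) β')) *
          (∫ z, (G z - ∫ z', G z' ∂(wilsonMeasure (d := 3) (L := L) (fundamentalRep (Fin 2)) β')) ∂(κ t.toNNReal y))
          ∂(wilsonMeasure (d := 3) (L := L) (fundamentalRep (Fin 2)) β'))) :
    0 ≤ σ2 ∧
    (∀ θ : ℝ, Tendsto (fun T : ℝ => ∫ ω, Complex.exp (((θ * ((Real.sqrt T)⁻¹ * ∫ r in Ioc (0 : ℝ) T,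
        (G (U r.toNNReal ω) - ∫ z, G z ∂(wilsonMeasure (d := 3) (L := L) (fundamentalRep (Fin 2)) β'))) : ℝ) : ℂ) * Complex.I) ∂P)
      atTop (𝓝 (Complex.exp (-((θ ^ 2 * σ2 / 2 : ℝ) : ℂ))))) ∧
    ∀ (Ω' : Type) [MeasurableSpace Ω'] (P' : Measure Ω') [IsProbabilityMeasure P'] (Y : Ω' → ℝ),
      HasLaw Y (gaussianReal 0 σ2.toNNReal) P' → ∀ (Tn : ℕ → ℝ), Tendsto Tn atTop atTop →
      TendstoInDistribution (fun (n : ℕ) ω => (Real.sqrt (Tn n))⁻¹ * ∫ r in Ioc (0 : ℝ) (Tn n),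
        (G (U r.toNNReal ω) - ∫ z, G z ∂(wilsonMeasure (d := 3) (L := L) (fundamentalRep (Fin 2)) β'))) atTop Y (fun _ => P) P' := by
  classical
  haveI := secondCountableTopology_su2
  haveI := borelSpace_config L
  set μ : Measure (GaugeConfig 3 L (Matrix.specialUnitaryGroup (Fin 2) ℂ)) :=
    wilsonMeasure (d := 3) (L := L) (fundamentalRep (Fin 2)) β' with hμ
  set m : ℝ := ∫ z, G z ∂μ with hm
  set Gh : GaugeConfig 3 L (Matrix.specialUnitaryGroup (Fin 2) ℂ) → ℝ := fun z => G z - m with hGh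
  have hGhm : Measurable Gh := hGc.measurable.sub measurable_const
  /- ### 1. The regular flow on the same space and pathwise uniqueness -/
  obtain ⟨V, -, hV, hVprog, -, -, -⟩ := exists_regularFlow L β' hW
  have hprog : ∀ i : ℝ≥0, Measurable[@Prod.instMeasurableSpace (Set.Iic i) Ω inferInstance (hW.natFiltration i)]
      (fun q : Set.Iic i × Ω => V x q.1 q.2) := fun i =>
    (hVprog i).comp (measurable_fst.prodMk (measurable_const.prodMk measurable_snd))
  have hae : ∀ᵐ ω ∂P, ∀ t, U t ω = V x t ω := latticeLangevin_pathwise_unique hW β' x hU0 (hV x).1 hU (hV x).2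
  -- the statistics
  set stat : ℝ → Ω → ℝ := fun T ω => (Real.sqrt T)⁻¹ * ∫ r in Ioc (0 : ℝ) T, Gh (U r.toNNReal ω) with hstat
  set statV : ℝ → Ω → ℝ := fun T ω => (Real.sqrt T)⁻¹ * ∫ r in Ioc (0 : ℝ) T, Gh (V x r.toNNReal ω) with hstatV
  have hstat_ae : ∀ T, stat T =ᵐ[P] statV T := fun T => by
    filter_upwards [hae] with ω hω
    simp only [hstat, hstatV]
    have : (fun r : ℝ => Gh (U r.toNNReal ω)) = fun r : ℝ => Gh (V x r.toNNReal ω) := funext fun r => by rw [hω]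
    rw [this]
  have hpathm : Measurable fun q : Ω × ℝ => V x q.2.toNNReal q.1 :=
    measurable_uncurry_of_prog (Z := V x) (fun n : ℕ => hW.natFiltration n) (fun n => hW.natFiltration.le n) (fun n => hprog n)
  have hstatVm : ∀ T, Measurable (statV T) := fun T => by
    have h1 : Measurable (Function.uncurry fun (ω : Ω) (r : ℝ) => Gh (V x r.toNNReal ω)) := hGhm.comp hpathm
    exact ((h1.stronglyMeasurable.integral_prod_right' (ν := volume.restrict (Ioc (0 : ℝ) T))).measurable).const_mul _
  /- ### 2. The finite-time estimate (file 94b) for the regular flow -/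
  obtain ⟨βu, K, hβ0, hK, hest⟩ := norm_charFun_timeIntegral_sub_gaussian_le_of_prog L β'
  have hσ0 : 0 ≤ σ2 := (hest κ hreal x Ω P W hW (V x) (hV x).1 (hV x).2 hprog G hGc hG1 σ2 hσ2 1 one_pos 1 le_rfl 0).1
  -- block parameters as functions of `T`
  set q : ℝ → ℝ := fun T => Real.sqrt (Real.sqrt T) with hq
  set Jf : ℝ → ℕ := fun T => ⌈T / q T⌉₊ with hJf
  set bf : ℝ → ℝ := fun T => T / (Jf T : ℝ) with hbf
  set η : ℝ → ℝ := fun b => K + 2 * βu * ((b * σ2 + K) / Real.sqrt (1 + b) + Real.sqrt (1 + b)) + 4 * βu ^ 2 with hη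
  set Ef : ℝ → ℝ := fun T => η (bf T) / bf T with hEf
  set Bf : ℝ → ℝ := fun T => (2 * βu + 2 * bf T) / Real.sqrt T with hBf
  set Φ : ℝ → ℝ → ℝ := fun θ T => Real.exp (θ ^ 2 * σ2 / 2) * (θ ^ 2 * Ef T + |θ| ^ 3 * Real.exp (|θ| * Bf T) * Bf T * (σ2 + Ef T) +
      θ ^ 4 * σ2 ^ 2 / 4 * (Jf T : ℝ)⁻¹ + (|θ| * Bf T + θ ^ 2 * Bf T ^ 2 / 2) * (θ ^ 2 * σ2 / 2)) +
    |θ| * (2 * βu) * (Real.sqrt T)⁻¹ with hΦ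
  -- elementary facts for `T ≥ 1`
  have hfacts : ∀ T : ℝ, 1 ≤ T → 1 ≤ (Jf T : ℝ) ∧ (Jf T : ℝ) * bf T = T ∧ q T / 2 ≤ bf T ∧ bf T ≤ q T ∧ q T ≤ (Jf T : ℝ) := by
    intro T hT
    obtain ⟨hq1, hqT, hq2⟩ := sqrt_sqrt_facts hT
    have hT0 : 0 < T := by linarith
    have hq0 : 0 < q T := by simp only [hq]; linarith
    have hTq : 0 < T / q T := div_pos hT0 hq0
    have hJge : T / q T ≤ (Jf T : ℝ) := Nat.le_ceil _
    have hJle : (Jf T : ℝ) ≤ T / q T + 1 := (Nat.ceil_lt_add_one hTq.le).le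
    have hJ0 : 0 < (Jf T : ℝ) := hTq.trans_le hJge
    have hJ1 : 1 ≤ (Jf T : ℝ) := by
      have : (1 : ℕ) ≤ Jf T := Nat.one_le_iff_ne_zero.2 (by
        intro h0; have : (Jf T : ℝ) = 0 := by exact_mod_cast h0
        linarith)
      exact_mod_cast this
    refine ⟨hJ1, by simp only [hbf]; field_simp, ?_, ?_, ?_⟩
    · -- `b ≥ q/2` from `J ≤ T/q + 1 ≤ 2T/q`
      have h2 : T / q T + 1 ≤ 2 * T / q T := by
        rw [div_add_one hq0.ne', div_le_div_iff₀ hq0 hq0]; nlinarith [hqT, hq0]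
      simp only [hbf]
      rw [div_le_div_iff₀ (by norm_num : (0 : ℝ) < 2) hJ0]
      calc q T * (Jf T : ℝ) ≤ q T * (2 * T / q T) := mul_le_mul_of_nonneg_left (hJle.trans h2) hq0.le
        _ = T * 2 := by field_simp
    · -- `b ≤ q` from `J ≥ T/q`
      simp only [hbf]
      rw [div_le_iff₀ hJ0]
      calc T = q T * (T / q T) := by field_simp
        _ ≤ q T * (Jf T : ℝ) := mul_le_mul_of_nonneg_left hJge hq0.le
    · -- `q ≤ J` from `T/q = q³ ≥ q`
      refine le_trans ?_ hJge
      rw [le_div_iff₀ hq0]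
      have hq4 : q T ^ 4 = T := by
        have : q T ^ 4 = (q T ^ 2) ^ 2 := by ring
        rw [this]; simp only [hq] at hq2 ⊢; rw [hq2, Real.sq_sqrt hT0.le]
      nlinarith [hq4, hq1]
  /- ### 3. The block parameters tend to their limits -/
  have hq_top : Tendsto q atTop atTop := Real.tendsto_sqrt_atTop.comp Real.tendsto_sqrt_atTop
  have hsqrt_inv : Tendsto (fun T : ℝ => (Real.sqrt T)⁻¹) atTop (𝓝 0) := tendsto_inv_atTop_zero.comp Real.tendsto_sqrt_atTop
  have hq_inv : Tendsto (fun T : ℝ => (q T)⁻¹) atTop (𝓝 0) := tendsto_inv_atTop_zero.comp hq_top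
  have hb_top : Tendsto bf atTop atTop := by
    refine tendsto_atTop_mono' atTop ?_ (hq_top.atTop_div_const (by norm_num : (0 : ℝ) < 2))
    filter_upwards [eventually_ge_atTop (1 : ℝ)] with T hT
    exact (hfacts T hT).2.2.1
  have hE : Tendsto Ef atTop (𝓝 0) := (tendsto_blockDefect_div_atTop K βu σ2).comp hb_top
  have hB : Tendsto Bf atTop (𝓝 0) := by
    have hup : Tendsto (fun T : ℝ => 2 * βu * (Real.sqrt T)⁻¹ + 2 * (q T)⁻¹) atTop (𝓝 0) := by
      simpa using (hsqrt_inv.const_mul (2 * βu)).add (hq_inv.const_mul 2)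
    refine tendsto_of_tendsto_of_tendsto_of_le_of_le' tendsto_const_nhds hup ?_ ?_
    · filter_upwards [eventually_ge_atTop (1 : ℝ)] with T hT
      have hb0 : 0 ≤ bf T := by have := (hfacts T hT).2.2.1; have := (sqrt_sqrt_facts hT).1; simp only [hq] at *; linarith
      simp only [hBf]; positivity
    · filter_upwards [eventually_ge_atTop (1 : ℝ)] with T hT
      obtain ⟨-, -, -, hbq, -⟩ := hfacts T hT
      obtain ⟨hq1, -, hq2⟩ := sqrt_sqrt_facts hT
      have hq0 : 0 < q T := by simp only [hq]; linarith
      have hsT : Real.sqrt T = q T * q T := by simp only [hq] at hq2 ⊢; rw [← pow_two]; exact hq2.symm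
      simp only [hBf]
      rw [hsT, add_div]
      refine add_le_add (le_of_eq (div_eq_mul_inv _ _)) ?_
      rw [div_le_iff₀ (by positivity)]
      calc 2 * bf T ≤ 2 * q T := by linarith
        _ = 2 * (q T)⁻¹ * (q T * q T) := by field_simp
  have hJ : Tendsto (fun T => (Jf T : ℝ)⁻¹) atTop (𝓝 0) := by
    refine tendsto_of_tendsto_of_tendsto_of_le_of_le' tendsto_const_nhds hq_inv ?_ ?_
    · filter_upwards [eventually_ge_atTop (1 : ℝ)] with T hT
      exact inv_nonneg.2 (by have := (hfacts T hT).1; linarith)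
    · filter_upwards [eventually_ge_atTop (1 : ℝ)] with T hT
      obtain ⟨-, -, -, -, hqJ⟩ := hfacts T hT
      have hq0 : 0 < q T := by have := (sqrt_sqrt_facts hT).1; simp only [hq] at *; linarith
      exact inv_anti₀ hq0 hqJ
  have hΦ0 : ∀ θ : ℝ, Tendsto (Φ θ) atTop (𝓝 0) := by
    intro θ
    have hexpB : Tendsto (fun T => Real.exp (|θ| * Bf T)) atTop (𝓝 1) := by
      have h0 : Tendsto (fun T => |θ| * Bf T) atTop (𝓝 0) := by simpa using hB.const_mul |θ|
      have := (Real.continuous_exp.tendsto 0).comp h0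
      rw [Real.exp_zero] at this
      exact this
    have h1 := hE.const_mul (θ ^ 2)
    have h2 := ((hexpB.const_mul (|θ| ^ 3)).mul hB).mul (hE.const_add σ2)
    have h3 := hJ.const_mul (θ ^ 4 * σ2 ^ 2 / 4)
    have h4 := ((hB.const_mul |θ|).add ((hB.pow 2).const_mul (θ ^ 2) |>.div_const 2)).mul_const (θ ^ 2 * σ2 / 2)
    have h5 := hsqrt_inv.const_mul (|θ| * (2 * βu))
    have hall := ((((h1.add h2).add h3).add h4).const_mul (Real.exp (θ ^ 2 * σ2 / 2))).add h5
    simp only [mul_zero, zero_mul, add_zero, mul_one, zero_pow two_ne_zero, zero_div] at hall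
    refine hall.congr' (Eventually.of_forall fun T => ?_)
    simp only [hΦ]
  /- ### 4. The bound `‖φ_T − e^(−θ²σ²/2)‖ ≤ Φ θ T` for `T ≥ 1` -/
  have hbound : ∀ θ : ℝ, ∀ T : ℝ, 1 ≤ T →
      ‖(∫ ω, Complex.exp (((θ * statV T ω : ℝ) : ℂ) * Complex.I) ∂P) - Complex.exp (-((θ ^ 2 * σ2 / 2 : ℝ) : ℂ))‖ ≤ Φ θ T := by
    intro θ T hT
    obtain ⟨hJ1, hJb, hbq2, -, -⟩ := hfacts T hT
    have hq0 : 0 < q T := by have := (sqrt_sqrt_facts hT).1; simp only [hq] at *; linarith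
    have hb0 : 0 < bf T := lt_of_lt_of_le (by positivity) hbq2
    have hJ1' : 1 ≤ Jf T := by exact_mod_cast hJ1
    have h := (hest κ hreal x Ω P W hW (V x) (hV x).1 (hV x).2 hprog G hGc hG1 σ2 hσ2 (bf T) hb0 (Jf T) hJ1' θ).2
    rw [hJb] at h
    simp only [hΦ, hEf, hBf, hη, hstatV]
    exact h
  /- ### 5. Characteristic functions converge (for `V`, then for `U`) -/
  have hcharV : ∀ θ : ℝ, Tendsto (fun T : ℝ => ∫ ω, Complex.exp (((θ * statV T ω : ℝ) : ℂ) * Complex.I) ∂P) atTop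
      (𝓝 (Complex.exp (-((θ ^ 2 * σ2 / 2 : ℝ) : ℂ)))) := fun θ => by
    refine tendsto_iff_norm_sub_tendsto_zero.2 (squeeze_zero_norm' ?_ (hΦ0 θ))
    filter_upwards [eventually_ge_atTop (1 : ℝ)] with T hT
    rw [norm_norm]; exact hbound θ T hT
  have hcharU : ∀ θ : ℝ, ∀ T : ℝ, ∫ ω, Complex.exp (((θ * stat T ω : ℝ) : ℂ) * Complex.I) ∂P =
      ∫ ω, Complex.exp (((θ * statV T ω : ℝ) : ℂ) * Complex.I) ∂P := fun θ T =>
    integral_congr_ae (by filter_upwards [hstat_ae T] with ω hω; rw [hω])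
  refine ⟨hσ0, fun θ => ?_, fun Ω' _ P' _ Y hY Tn hTn => ?_⟩
  · exact (hcharV θ).congr fun T => (hcharU θ T).symm
  · have hXV : ∀ θ : ℝ, Tendsto (fun n : ℕ => ∫ ω, Complex.exp (((θ * statV (Tn n) ω : ℝ) : ℂ) * Complex.I) ∂P) atTop
        (𝓝 (Complex.exp (-((θ ^ 2 * σ2 / 2 : ℝ) : ℂ)))) := fun θ => (hcharV θ).comp hTn
    have hV := tendstoInDistribution_of_tendsto_charFun_gaussian (fun n => hstatVm (Tn n)) hσ0 hXV hY
    exact hV.congr (fun n => (hstat_ae (Tn n)).symm) (ae_eq_refl _)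

end Summit.QuantumFields.YangMills.Theorems.ColdStartUniversality

end
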